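import Summits.Ventures.PackingBounds.Energy.NewtonCertificate

/-!
# Newton-form LP certificates: the DEFICIT (equality-case) inequality

Framing: lottery ticket; floor = certified bounds/negative ranges. Venture `PackingBounds` (cell
`pub-packcert`, seat `pub-packcert-energy`), energy-minimisation family, universal optimality
infrastructure — the complement of `NewtonCertificate.lean` needed for UNIQUENESS of minimisers
(Cohn–Kumar 2007, Thm. 1.2, uniqueness clause).

In the setting of `NewtonCert.energy_ge` (node values `v_i ≥ 0`, `ω_D ≥ 0` on `u ≥ 0`, Gegenbauer table
`G ≥ 0` of the partial products, design identities) the Newton expansion of `u^k` has a remainder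
`r_k(u) ω_D(u)` with `r_k(u) ≥ u^{k-D}` for `k ≥ D` (`newton_exists_strict`: the leading Newton
coefficient of `u^{D-1}` is `1`, and `r_{k+1}(u) = c_{D-1}(k) + u r_k(u)`). Applying the LP bound of
Yudin / Cohn–Kumar to the certificate `h_k` ITSELF (it has nonnegative Gegenbauer coefficients) gives
`Σ_{x≠y} h_k ≥ N Σ_i m_i v_i^k`, whence the **deficit inequality**
`Σ_{x≠y} (1+⟨x,y⟩)^k - N Σ_i m_i v_i^k ≥ Σ_{x≠y} (1+⟨x,y⟩)^{k-D} ω_D(1+⟨x,y⟩) (≥ 0)`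
(`energy_deficit`): a configuration attaining the bound for one `k ≥ D` has ALL its inner products at
the nodes (or at `-1`). Used in `Configurations/E8EnergyRigidity.lean`.

## References
* H. Cohn, A. Kumar, *Universally optimal distribution of points on spheres*, J. Amer. Math. Soc.
  20 (2007) 99–148, Thm. 1.2 (uniqueness), Prop. 4.1, §§5–6. [`CohnKumar2006`]
-/

noncomputable section

namespace Summit.Ventures.PackingBounds.Energy

open Finset Literature.Analysis.SpecialFunctions Literature.Geometry.DiscreteGeometry

namespace NewtonCert

variable (v : ℕ → ℝ)

/-- **Newton expansion of `u^k`, with the size of the remainder.** As `newton_exists`, plus: the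
coefficients above the degree vanish, the leading one is `1` (`k < D`), and for `k ≥ D` the remainder
satisfies `r(u) ≥ u^{k-D}` on `u ≥ 0`. [folklore] -/
theorem newton_exists_strict (hv : ∀ i, 0 ≤ v i) (D : ℕ) (hD : 1 ≤ D) :
    ∀ k : ℕ, ∃ c : ℕ → ℝ, ∃ r : ℝ → ℝ, (∀ j, 0 ≤ c j) ∧ (∀ u, 0 ≤ u → 0 ≤ r u) ∧
      (∀ u : ℝ, u ^ k = ∑ j ∈ range D, c j * ∏ i ∈ range j, (u - v i) +
        r u * ∏ i ∈ range D, (u - v i)) ∧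
      (∀ j, k < j → c j = 0) ∧ (k < D → c k = 1) ∧ (D ≤ k → ∀ u, 0 ≤ u → u ^ (k - D) ≤ r u) := by
  intro k
  induction k with
  | zero =>
    refine ⟨fun j => if j = 0 then 1 else 0, fun _ => 0, fun j => ?_, fun _ _ => le_rfl, fun u => ?_,
      fun j hj => ?_, fun _ => ?_, fun h => ?_⟩
    · dsimp only; split_ifs <;> norm_num
    · simp only [pow_zero, ite_mul, one_mul, zero_mul, Finset.sum_ite_eq', Finset.mem_range,
        add_zero]
      rw [if_pos (by omega), Finset.prod_range_zero]
    · dsimp only; rw [if_neg (by omega)]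
    · simp
    · omega
  | succ k ih =>
    obtain ⟨c, r, hc, hr, hexp, hzero, hlead, hrem⟩ := ih
    refine ⟨fun j => v j * c j + if j = 0 then 0 else c (j - 1), fun u => c (D - 1) + u * r u,
      fun j => ?_, fun u hu => add_nonneg (hc _) (mul_nonneg hu (hr u hu)), fun u => ?_,
      fun j hj => ?_, fun hk => ?_, fun hk u hu => ?_⟩
    · dsimp only
      refine add_nonneg (mul_nonneg (hv j) (hc j)) ?_
      split_ifs
      · exact le_rfl
      · exact hc _
    · rw [pow_succ, hexp u, newton_step v D hD c (r u) u]
    · dsimp only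
      rw [hzero j (by omega), mul_zero, zero_add, if_neg (by omega), hzero (j - 1) (by omega)]
    · dsimp only
      rw [hzero (k + 1) (by omega), mul_zero, zero_add, if_neg (by omega),
        show k + 1 - 1 = k from rfl, hlead (by omega)]
    · dsimp only
      rcases Nat.eq_or_lt_of_le hk with h | h
      · -- `k + 1 = D`: the remainder is `c_{D-1} + u r(u) ≥ 1`
        have hkD : k = D - 1 := by omega
        rw [← h, Nat.sub_self, pow_zero, ← hkD, hlead (by omega)]
        linarith [mul_nonneg hu (hr u hu)]
      · have hDk : D ≤ k := by omega
        have h1 := hrem hDk u hu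
        have : u ^ (k + 1 - D) = u * u ^ (k - D) := by
          rw [show k + 1 - D = (k - D) + 1 by omega, pow_succ, mul_comm]
        rw [this]
        calc u * u ^ (k - D) ≤ u * r u := mul_le_mul_of_nonneg_left h1 hu
          _ ≤ c (D - 1) + u * r u := le_add_of_nonneg_left (hc _)

open scoped Classical in
/-- **Deficit inequality for Newton-form certificates.** Under the hypotheses of
`NewtonCert.energy_ge` and `k ≥ D`, every `N`-point configuration `C ⊂ S^{n-1}` satisfies
`N Σ_{i<M} m_i v_i^k + Σ_{x ≠ y} (1+⟨x,y⟩)^{k-D} ω_D(1+⟨x,y⟩) ≤ Σ_{x ≠ y} (1+⟨x,y⟩)^k` — the energy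
exceeds the bound by at least the (nonnegative) sum of `u^{k-D} ω_D(u)` over the pairs.
[cite: CohnKumar2006, Theorem 1.2 and §6] -/
theorem energy_deficit {n : ℕ} {μ : ℝ} (hn : (n : ℝ) = 2 * μ + 2) (hμ : 0 < μ)
    (D : ℕ) (hD : 1 ≤ D) (v : ℕ → ℝ) (hv : ∀ i, 0 ≤ v i)
    (hωD : ∀ u : ℝ, 0 ≤ u → 0 ≤ ∏ i ∈ range D, (u - v i))
    (G : ℕ → ℕ → ℝ) (hG : ∀ j i, 0 ≤ G j i)
    (hGid : ∀ j < D, ∀ t : ℝ,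
      ∏ i ∈ range j, (1 + t - v i) = ∑ i ∈ range D, G j i * gegenbauerSum μ i t)
    (N M : ℕ) (hM : M ≤ D) (mult : ℕ → ℝ)
    (hdesign : ∀ j < D, (N : ℝ) * G j 0 =
      ∏ i ∈ range j, (2 - v i) + ∑ i ∈ range M, mult i * ∏ i' ∈ range j, (v i - v i'))
    (k : ℕ) (hk : D ≤ k) (C : Finset (EuclideanSpace ℝ (Fin n))) (h1 : ∀ x ∈ C, ‖x‖ = 1)
    (hN : C.card = N) :
    (N : ℝ) * ∑ i ∈ range M, mult i * v i ^ k +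
        ∑ x ∈ C, ∑ y ∈ C.erase x,
          (1 + inner ℝ x y) ^ (k - D) * ∏ i ∈ range D, (1 + inner ℝ x y - v i) ≤
      ∑ x ∈ C, ∑ y ∈ C.erase x, (1 + inner ℝ x y) ^ k := by
  obtain ⟨c, r, hc, hr, hexp, -, -, hrem⟩ := newton_exists_strict v hv D hD k
  -- Gegenbauer coefficients of the certificate `h_k = Σ_j c_j ω_j(1+t)`
  set α : ℕ → ℝ := fun i => ∑ j ∈ range D, c j * G j i with hαdef
  have hα : ∀ i, 0 ≤ α i := fun i =>
    Finset.sum_nonneg fun j _ => mul_nonneg (hc j) (hG j i)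
  have hswap : ∀ t : ℝ, ∑ i ∈ range D, α i * gegenbauerSum μ i t =
      ∑ j ∈ range D, c j * ∏ i ∈ range j, (1 + t - v i) := by
    intro t
    calc ∑ i ∈ range D, α i * gegenbauerSum μ i t
          = ∑ i ∈ range D, ∑ j ∈ range D, c j * G j i * gegenbauerSum μ i t := by
            refine Finset.sum_congr rfl fun i _ => ?_
            rw [hαdef, Finset.sum_mul]
      _ = ∑ j ∈ range D, ∑ i ∈ range D, c j * G j i * gegenbauerSum μ i t :=
            Finset.sum_comm
      _ = ∑ j ∈ range D, c j * ∏ i ∈ range j, (1 + t - v i) := by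
            refine Finset.sum_congr rfl fun j hj => ?_
            rw [hGid j (Finset.mem_range.1 hj) t, Finset.mul_sum]
            exact Finset.sum_congr rfl fun i _ => by ring
  have hD' : D - 1 + 1 = D := Nat.sub_add_cancel hD
  -- the LP bound applied to the certificate itself
  set h : ℝ → ℝ := fun t => ∑ j ∈ range D, c j * ∏ i ∈ range j, (1 + t - v i) with hhdef
  have hH : ∀ t : ℝ, -1 ≤ t → t < 1 →
      ∑ i ∈ range (D - 1 + 1), α i * gegenbauerSum μ i t ≤ h t := by
    intro t _ _
    rw [hD', hswap t]
  have key := EnergyLP.energy_ge_inner hn hμ (D - 1) α hα h hH C h1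
  have h2 : ∑ j ∈ range D, c j * ∏ i ∈ range j, (1 + 1 - v i) =
      ∑ j ∈ range D, c j * ∏ i ∈ range j, ((2 : ℝ) - v i) :=
    Finset.sum_congr rfl fun j _ => by
      rw [Finset.prod_congr rfl fun i _ => by rw [show (1 : ℝ) + 1 = 2 by norm_num]]
  have hα0 : α 0 = ∑ j ∈ range D, c j * G j 0 := by rw [hαdef]
  rw [hD', hN, hswap 1, h2, hα0] at key
  -- evaluate the bound: `N² α_0 - N h_k(1) = N Σ_i m_i v_i^k`
  have hval : ∀ j ∈ range D, (N : ℝ) * G j 0 - ∏ i ∈ range j, (2 - v i) =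
      ∑ i ∈ range M, mult i * ∏ i' ∈ range j, (v i - v i') := fun j hj => by
    rw [hdesign j (Finset.mem_range.1 hj)]; ring
  have hnode : ∀ i ∈ range M, ∑ j ∈ range D, c j * ∏ i' ∈ range j, (v i - v i') = v i ^ k := by
    intro i hi
    have h := hexp (v i)
    rw [omega_node v (lt_of_lt_of_le (Finset.mem_range.1 hi) hM), mul_zero, add_zero] at h
    exact h.symm
  have hbound : (N : ℝ) * ∑ i ∈ range M, mult i * v i ^ k =
      (N : ℝ) ^ 2 * ∑ j ∈ range D, c j * G j 0 -
          (N : ℝ) * ∑ j ∈ range D, c j * ∏ i ∈ range j, (2 - v i) := by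
    calc (N : ℝ) * ∑ i ∈ range M, mult i * v i ^ k
          = (N : ℝ) * ∑ i ∈ range M, mult i *
              ∑ j ∈ range D, c j * ∏ i' ∈ range j, (v i - v i') := by
            congr 1; exact Finset.sum_congr rfl fun i hi => by rw [hnode i hi]
      _ = (N : ℝ) * ∑ j ∈ range D, c j *
              ∑ i ∈ range M, mult i * ∏ i' ∈ range j, (v i - v i') := by
            congr 1
            rw [Finset.sum_congr rfl fun i _ => Finset.mul_sum (range D) _ (mult i), Finset.sum_comm]
            refine Finset.sum_congr rfl fun j _ => ?_
            rw [Finset.mul_sum]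
            exact Finset.sum_congr rfl fun i _ => by ring
      _ = (N : ℝ) * ∑ j ∈ range D, c j * ((N : ℝ) * G j 0 - ∏ i ∈ range j, (2 - v i)) := by
            congr 1; exact Finset.sum_congr rfl fun j hj => by rw [hval j hj]
      _ = (N : ℝ) ^ 2 * ∑ j ∈ range D, c j * G j 0 -
            (N : ℝ) * ∑ j ∈ range D, c j * ∏ i ∈ range j, (2 - v i) := by
            rw [Finset.mul_sum, Finset.mul_sum, Finset.mul_sum, ← Finset.sum_sub_distrib]
            exact Finset.sum_congr rfl fun j _ => by ring
  -- the energy splits as `E_h + Σ r ω_D`, and `r(u) ω_D(u) ≥ u^{k-D} ω_D(u)` termwise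
  have hsplit : ∑ x ∈ C, ∑ y ∈ C.erase x, (1 + inner ℝ x y) ^ k =
      ∑ x ∈ C, ∑ y ∈ C.erase x, h (inner ℝ x y) +
        ∑ x ∈ C, ∑ y ∈ C.erase x,
          r (1 + inner ℝ x y) * ∏ i ∈ range D, (1 + inner ℝ x y - v i) := by
    rw [← Finset.sum_add_distrib]
    refine Finset.sum_congr rfl fun x _ => ?_
    rw [← Finset.sum_add_distrib]
    refine Finset.sum_congr rfl fun y _ => ?_
    rw [hexp (1 + inner ℝ x y)]
  have hterm : ∀ x ∈ C, ∀ y ∈ C.erase x,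
      (1 + inner ℝ x y) ^ (k - D) * ∏ i ∈ range D, (1 + inner ℝ x y - v i) ≤
        r (1 + inner ℝ x y) * ∏ i ∈ range D, (1 + inner ℝ x y - v i) := by
    intro x hx y hy
    have hb := inner_mem_Ico_of_norm_eq_one (h1 x hx) (h1 y (Finset.mem_of_mem_erase hy))
      (Finset.ne_of_mem_erase hy).symm
    have hu : (0 : ℝ) ≤ 1 + inner ℝ x y := by linarith [hb.1]
    exact mul_le_mul_of_nonneg_right (hrem hk _ hu) (hωD _ hu)
  have hsum_le : ∑ x ∈ C, ∑ y ∈ C.erase x,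
      (1 + inner ℝ x y) ^ (k - D) * ∏ i ∈ range D, (1 + inner ℝ x y - v i) ≤
      ∑ x ∈ C, ∑ y ∈ C.erase x,
        r (1 + inner ℝ x y) * ∏ i ∈ range D, (1 + inner ℝ x y - v i) :=
    Finset.sum_le_sum fun x hx => Finset.sum_le_sum fun y hy => hterm x hx y hy
  rw [hsplit, hbound]
  linarith

end NewtonCert

end Summit.Ventures.PackingBounds.Energy

end
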